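import Summits.BirchSwinnertonDyer.Rank1Residual.SecondDescent.HesseCokernelInvariants

/-!
# Hesse-configuration cokernel, part 2: `ker ∂₂ = Aff(X, 𝔽₃)` and the `⟨one translation⟩` cell
# (`dim 𝒦_v = 2`, `h⁰(G_v, coker ∂₂) = 3`) — kernel-checked table entries of instrument B-1 `SEL3ALT`
# (cell `b2b-bsdres`, CLASS-CLOSURE instrument builder 4 = seat cc-eng-4, GEN 94)

HONEST FRAMING (cell `b2b-bsdres`, run/shared/lean/b2b/bsd-rank1-residual/, verbatim in every
file): the goal of the cell is to DELETE the COMBINATION-SHAPED residual classes of the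
Birch–Swinnerton-Dyer formula for ALL analytic-rank `≤ 1` elliptic curves over `ℚ` — "full BSD
formula for every rank `≤ 1` curve in class `C`" assembled STRICTLY from published theorems — so
that the rank-`≤ 1` remainder becomes exactly the CONSTRUCTION-SHAPED classes, which are TYPED
(missing-input `Prop`s), NOT attempted. This is not "finishing BSD". THIS FILE is a class-free TOOL
file continuing `HesseCokernelInvariants.lean` (same notation: `pt`, `ln`, `inc = ∂₂`, `actX_g`,
`actY_g`, `projC`; same method: explicit `𝔽₃`-matrix certificates checked by `decide +kernel`). It is
NOT a Literature fact, NOT a class theorem, closes no item, books nothing, moves no RESIDUAL-MAP mark.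

## Contents
(A) `inc_mulVec_eq_zero_iff`: **`ker ∂₂ = Aff(X, 𝔽₃)`** — the exactness of
`0 → Aff(X, μ₃) → Map(X, μ₃) →∂₂ Map(Y₂, μ₃)` (Creutz, *Second p-descents on elliptic curves*,
Math. Comp. 83 (2014), arXiv 1209.3085, §4.1–§4.2), with `affB` = the constant and the two coordinate
functions; and `const_not_mem_range`: the constant line-function (the class of the DIAGONAL twist
`(1, ζ₃)`) is never an induced norm — the source of the non-kernel invariant directions `x_v > 0`
at every `v ≡ 1 (mod 3)` (README-DEV33 §7.3 of `class-closure/eng-4/b1/stage/SEL3ALT-0.3.3-dev/`).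
(B) The local cell `G_v = ⟨one translation⟩` (README-DEV33 §7.3 table row 'translation by one
vector'; it is the cell of the instrument anomaly A-B1-116032by1: `v = 37 ≡ 1 (mod 9)`,
`E[3] ⊂ E(ℚ_v)`, `ξ_v` unramified of order `3`; here `G_v = ⟨t1⟩`, any non-zero translation being
conjugate): with `M′ := {θ : ∂₂(t1·θ − θ) = 0}` (`∂₂θ ∈ H⁰(G_v, ∂₂A)`) and
`M := {θ : t1·θ − θ constant}` (`[θ] ∈ H⁰(G_v, A/μ₃)`), Creutz's kernel
`𝒦_v = H⁰(G_v, ∂₂A) ⧸ ∂₂H⁰(G_v, A/μ₃)` (Prop. 5.11) is `M′/M` (`ker ∂₂ = Aff ⊂ M`), and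
`kv_decomposition` + `kvGens_mem` + `kvGens_independent` give `M′ = M ⊕ ⟨θ₁, θ₂⟩`:
**`dim 𝒦_v = 2`** — the value engine 3 reads from its `kvtable` and engine 1 from its `U_v`
diagnostic at that cell; `q_decomposition` + `qGens_invariant` + `qGens_independent` give
**`h⁰(⟨t1⟩, coker ∂₂) = 3`** (`hesse_h0Q.py`: 'translation by one vector: dimK 2, h0(Q) 3'), in
contrast with part 1's `exists_preimage_of_invariant` (adding `t2` and the Cartan element `c`
kills every invariant). These are the two finite-group numbers behind README-DEV33 §7.4's
prediction `need′ ≥ 1 at 37` for the `sel3alt033-validate` VA step; the local-field half of that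
prediction (`pr₁(ℋ⁰_v)` is `1`-dimensional) is not formalised here.
-/

namespace Summit.BirchSwinnertonDyer.Rank1Residual.SecondDescent.HesseCokernel

open Matrix

/-! ## `ker ∂₂` = the affine maps (Creutz §4.1: `1 → Aff(X, μ₃) → Map(X, μ₃) →∂₂ Map(Y₂, μ₃)`) -/

/-- The three basic affine functions on `AG(2,3)` as columns: the constant `1` and the two
coordinate functions `x ↦ x.1`, `x ↦ x.2` (so the column space of `affB` is `Aff(X, 𝔽₃)`,
dimension `3`). -/
def affB : Matrix (Fin 9) (Fin 3) (ZMod 3) :=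
  !![1, 0, 0; 1, 0, 1; 1, 0, 2; 1, 1, 0; 1, 1, 1; 1, 1, 2; 1, 2, 0; 1, 2, 1; 1, 2, 2]

/-- `affB`'s columns ARE `1`, `pt·.1`, `pt·.2`. -/
theorem affB_apply : ∀ i : Fin 9, affB i 0 = 1 ∧ affB i 1 = (pt i).1 ∧ affB i 2 = (pt i).2 := by
  decide

/-- Affine coordinates of a function: `(φ(0,0), φ(1,0) − φ(0,0), φ(0,1) − φ(0,0))`. -/
def affCoord : Matrix (Fin 3) (Fin 9) (ZMod 3) :=
  !![1, 0, 0, 0, 0, 0, 0, 0, 0; 2, 0, 0, 1, 0, 0, 0, 0, 0; 2, 1, 0, 0, 0, 0, 0, 0, 0]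

/-- A retraction certificate: `affRetract * inc + affB * affCoord = 1`. -/
def affRetract : Matrix (Fin 9) (Fin 12) (ZMod 3) :=
  !![0, 0, 0, 0, 0, 0, 0, 0, 0, 0, 0, 0; 0, 0, 0, 0, 0, 0, 0, 0, 0, 0, 0, 0; 1, 0, 0, 0, 0, 0, 0, 0, 0, 0, 0, 0; 0, 0, 0, 0, 0, 0, 0, 0, 0, 0, 0, 0; 0, 0, 1, 0, 2, 0, 0, 0, 0, 0, 0, 0; 0, 0, 1, 1, 2, 2, 0, 0, 0, 0, 0, 0; 0, 1, 0, 0, 0, 0, 0, 0, 0, 0, 0, 0; 0, 0, 2, 0, 1, 1, 0, 0, 0, 0, 0, 0; 0, 0, 0, 0, 1, 0, 0, 0, 0, 0, 0, 0]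

/-- Affine functions are in `ker ∂₂` (each line sums an affine function to `3·(value at its
centroid) = 0`). -/
theorem inc_mul_affB : inc * affB = 0 := by decide +kernel

/-- `affCoord` is a left inverse of `affB` (the three affine functions are independent). -/
theorem affCoord_mul_affB : affCoord * affB = 1 := by decide +kernel

/-- The retraction identity `φ = affRetract (∂₂ φ) + affB (affCoord φ)`. -/
theorem affRetract_mul_inc_add : affRetract * inc + affB * affCoord = 1 := by decide +kernel

/-- **`ker ∂₂ = Aff(X, 𝔽₃)`**: a function on the `9` flexes is killed by `∂₂` iff it is affine
(a combination of `1`, `x.1`, `x.2`); with `projC_mul_inclC` this is the exactness of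
`0 → Aff(X, 𝔽₃) (dim 3) → Map(X, 𝔽₃) (dim 9) →∂₂ Map(Y₂, 𝔽₃) (dim 12) → coker (dim 6) → 0`. -/
theorem inc_mulVec_eq_zero_iff (φ : Fin 9 → ZMod 3) :
    inc *ᵥ φ = 0 ↔ ∃ v : Fin 3 → ZMod 3, affB *ᵥ v = φ := by
  constructor
  · intro h
    refine ⟨affCoord *ᵥ φ, ?_⟩
    have e := congrArg (fun M => M *ᵥ φ) affRetract_mul_inc_add
    simp only [Matrix.add_mulVec, ← Matrix.mulVec_mulVec, h, Matrix.mulVec_zero, zero_add,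
      Matrix.one_mulVec] at e
    exact e
  · rintro ⟨v, rfl⟩
    rw [Matrix.mulVec_mulVec, inc_mul_affB, Matrix.zero_mulVec]

/-- The constant line-function `𝟙 ∈ Map(Y₂, 𝔽₃)` (the class of the DIAGONAL twist `(1, ζ₃)`) is
NOT an induced norm: `𝟙 ∉ im ∂₂` (README-DEV33 §7.3: summing a putative preimage over the four
lines through a point vs over three parallel lines gives `1 ≠ 0`). This is the source of the
non-kernel invariant directions `x_v > 0` at every `v ≡ 1 (mod 3)`. -/
theorem const_not_mem_range : ¬ ∃ φ, inc *ᵥ φ = fun _ => (1 : ZMod 3) := by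
  rw [exists_preimage_iff]; decide +kernel

/-! ## The `116032by1 @ 37` cell of README-DEV33 §7.3/§7.4: `G_v = ⟨one translation⟩`
(`v ≡ 1 (mod 9)`, `E[3] ⊂ E(ℚ_v)`, `ξ_v` unramified of order `3`): `dim 𝒦_v = 2` and
`h⁰(G_v, coker ∂₂) = 3` — the two `hesse_h0Q.py` table entries behind the VA prediction
`need′ ≥ 1 at 37`, kernel-checked (with `G_v = ⟨t1⟩`; any non-zero translation is conjugate). -/

/-- `constDiff θ = (θ_{i+1} − θ_0)_{i<8}`: kills exactly the constant functions. -/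
def constDiff : Matrix (Fin 8) (Fin 9) (ZMod 3) :=
  !![2, 1, 0, 0, 0, 0, 0, 0, 0; 2, 0, 1, 0, 0, 0, 0, 0, 0; 2, 0, 0, 1, 0, 0, 0, 0, 0; 2, 0, 0, 0, 1, 0, 0, 0, 0; 2, 0, 0, 0, 0, 1, 0, 0, 0; 2, 0, 0, 0, 0, 0, 1, 0, 0; 2, 0, 0, 0, 0, 0, 0, 1, 0; 2, 0, 0, 0, 0, 0, 0, 0, 1]

/-- Constants are killed by `constDiff`. -/
theorem constDiff_const : ∀ a : ZMod 3, constDiff *ᵥ (fun _ => a) = 0 := by decide +kernel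

/-- … and only constants: `constDiff θ = 0 → θ i = θ 0` (row `i − 1` reads `θ i − θ 0 = 0`). -/
theorem constDiff_eq_zero (θ : Fin 9 → ZMod 3) (h : constDiff *ᵥ θ = 0) : ∀ i, θ i = θ 0 := by
  have neg2 : ∀ x : ZMod 3, -(2 * x) = x := by decide
  intro i
  fin_cases i
  · rfl
  · have e := congrFun h 0
    simp [constDiff, Matrix.mulVec, dotProduct, Fin.sum_univ_succ] at e
    have e' := add_eq_zero_iff_neg_eq.mp e
    rw [neg2] at e'
    exact e'.symm
  · have e := congrFun h 1
    simp [constDiff, Matrix.mulVec, dotProduct, Fin.sum_univ_succ] at e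
    have e' := add_eq_zero_iff_neg_eq.mp e
    rw [neg2] at e'
    exact e'.symm
  · have e := congrFun h 2
    simp [constDiff, Matrix.mulVec, dotProduct, Fin.sum_univ_succ] at e
    have e' := add_eq_zero_iff_neg_eq.mp e
    rw [neg2] at e'
    exact e'.symm
  · have e := congrFun h 3
    simp [constDiff, Matrix.mulVec, dotProduct, Fin.sum_univ_succ] at e
    have e' := add_eq_zero_iff_neg_eq.mp e
    rw [neg2] at e'
    exact e'.symm
  · have e := congrFun h 4
    simp [constDiff, Matrix.mulVec, dotProduct, Fin.sum_univ_succ] at e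
    have e' := add_eq_zero_iff_neg_eq.mp e
    rw [neg2] at e'
    exact e'.symm
  · have e := congrFun h 5
    simp [constDiff, Matrix.mulVec, dotProduct, Fin.sum_univ_succ] at e
    have e' := add_eq_zero_iff_neg_eq.mp e
    rw [neg2] at e'
    exact e'.symm
  · have e := congrFun h 6
    simp [constDiff, Matrix.mulVec, dotProduct, Fin.sum_univ_succ] at e
    have e' := add_eq_zero_iff_neg_eq.mp e
    rw [neg2] at e'
    exact e'.symm
  · have e := congrFun h 7
    simp [constDiff, Matrix.mulVec, dotProduct, Fin.sum_univ_succ] at e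
    have e' := add_eq_zero_iff_neg_eq.mp e
    rw [neg2] at e'
    exact e'.symm

/-- Two explicit functions `θ₁, θ₂ : X → 𝔽₃` (columns) whose `∂₂`-images span
`𝒦_v = H⁰(⟨t1⟩, ∂₂A) ⧸ ∂₂H⁰(⟨t1⟩, A/μ₃)` (below). -/
def kvGens : Matrix (Fin 9) (Fin 2) (ZMod 3) :=
  !![1, 1; 1, 2; 1, 0; 0, 2; 0, 1; 0, 0; 0, 0; 0, 0; 0, 0]

/-- Coordinates along `θ₁, θ₂` (any linear extension works; this one was read off a basis). -/
def kvCoord : Matrix (Fin 2) (Fin 9) (ZMod 3) :=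
  !![0, 0, 1, 0, 0, 1, 0, 0, 1; 0, 0, 0, 0, 1, 2, 0, 2, 1]

/-- Certificate for `kv_identity`. -/
def kvCert : Matrix (Fin 8) (Fin 12) (ZMod 3) :=
  !![0, 0, 2, 0, 0, 0, 0, 0, 0, 0, 0, 0; 1, 0, 1, 0, 0, 0, 0, 0, 0, 0, 0, 0; 2, 0, 0, 0, 1, 0, 0, 0, 0, 0, 0, 0; 2, 0, 0, 0, 0, 0, 0, 0, 0, 0, 0, 0; 1, 0, 1, 0, 0, 0, 0, 0, 0, 0, 0, 0; 1, 0, 0, 0, 2, 0, 0, 0, 0, 0, 0, 0; 1, 0, 1, 0, 0, 0, 0, 0, 0, 0, 0, 0; 1, 0, 1, 0, 0, 0, 0, 0, 0, 0, 0, 0]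

/-- `θ₁, θ₂` lie in `M′ := {θ : ∂₂(t1·θ − θ) = 0}` (`⇔ ∂₂θ ∈ H⁰(⟨t1⟩, ∂₂A)`). -/
theorem kvGens_mem : inc * ((actX_t1 - 1) * kvGens) = 0 := by decide +kernel

/-- `θ₁, θ₂` are independent modulo `M := {θ : t1·θ − θ constant}` (`⇔ [θ] ∈ H⁰(⟨t1⟩, A/μ₃)`):
no non-trivial combination has constant `t1·θ − θ`. -/
theorem kvGens_independent : ∀ c : Fin 2 → ZMod 3,
    constDiff *ᵥ ((actX_t1 - 1) *ᵥ (kvGens *ᵥ c)) = 0 → c = 0 := by decide +kernel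

/-- The span certificate: `constDiff (t1 − 1) (1 − kvGens kvCoord) = kvCert · ∂₂ (t1 − 1)`. -/
theorem kv_identity : constDiff * ((actX_t1 - 1) * (1 - kvGens * kvCoord)) =
    kvCert * (inc * (actX_t1 - 1)) := by decide +kernel

/-- **`dim 𝒦_v = 2` at the `⟨one translation⟩` cell**: every `θ ∈ M′` is, modulo `M`, the
combination `kvGens (kvCoord θ)` of `θ₁, θ₂` — with `kvGens_mem` / `kvGens_independent`,
`M′ = M ⊕ ⟨θ₁, θ₂⟩`, i.e. `𝒦_v ≅ M′/M` (`ker ∂₂ = Aff ⊂ M`) is `2`-dimensional, as engine 3's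
`kvtable` and `hesse_h0Q.py` ('translation by one vector: dimK 2') say. -/
theorem kv_decomposition (θ : Fin 9 → ZMod 3) (h : inc *ᵥ ((actX_t1 - 1) *ᵥ θ) = 0) :
    constDiff *ᵥ ((actX_t1 - 1) *ᵥ (θ - kvGens *ᵥ (kvCoord *ᵥ θ))) = 0 := by
  have e := congrArg (fun M => M *ᵥ θ) kv_identity
  have hs : (1 - kvGens * kvCoord) *ᵥ θ = θ - kvGens *ᵥ (kvCoord *ᵥ θ) := by
    rw [Matrix.sub_mulVec, Matrix.one_mulVec, Matrix.mulVec_mulVec]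
  simp only [← Matrix.mulVec_mulVec] at e
  rw [hs, h, Matrix.mulVec_zero] at e
  exact e

/-- Three explicit line-functions `ψ₁, ψ₂, ψ₃` (columns) whose classes span
`H⁰(⟨t1⟩, coker ∂₂)`. -/
def qGens : Matrix (Fin 12) (Fin 3) (ZMod 3) :=
  !![0, 0, 0; 0, 0, 0; 0, 0, 0; 0, 0, 0; 0, 0, 0; 0, 0, 0; 0, 2, 1; 0, 2, 0; 0, 1, 1; 1, 0, 0; 0, 1, 0; 0, 0, 1]

/-- Coordinates along `[ψ₁], [ψ₂], [ψ₃]`. -/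
def qCoord : Matrix (Fin 3) (Fin 12) (ZMod 3) :=
  !![0, 0, 0, 0, 0, 1, 2, 0, 2, 1, 0, 2; 0, 0, 0, 0, 0, 1, 2, 2, 1, 0, 1, 0; 0, 2, 0, 1, 0, 2, 1, 0, 0, 0, 1, 0]

/-- Certificate for `q_identity`. -/
def qCert : Matrix (Fin 6) (Fin 6) (ZMod 3) :=
  !![2, 0, 0, 0, 0, 0; 0, 0, 0, 0, 2, 0; 1, 0, 0, 0, 2, 0; 2, 2, 0, 0, 0, 0; 1, 0, 0, 0, 0, 0; 2, 2, 0, 0, 1, 0]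

/-- Each `[ψ_j]` is `t1`-invariant in `coker ∂₂` (`(t1 − 1)ψ_j ∈ im ∂₂ = ker projC`). -/
theorem qGens_invariant : projC * ((actY_t1 - 1) * qGens) = 0 := by decide +kernel

/-- `[ψ₁], [ψ₂], [ψ₃]` are independent in `coker ∂₂`. -/
theorem qGens_independent : ∀ c : Fin 3 → ZMod 3, projC *ᵥ (qGens *ᵥ c) = 0 → c = 0 := by
  decide +kernel

/-- The span certificate: `projC (1 − qGens qCoord) = qCert · projC (t1 − 1)`. -/
theorem q_identity : projC * (1 - qGens * qCoord) = qCert * (projC * (actY_t1 - 1)) := by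
  decide +kernel

/-- **`h⁰(⟨t1⟩, coker ∂₂) = 3`**: every `t1`-invariant class `[ψ]` (i.e. `(t1 − 1)ψ ∈ im ∂₂`)
equals `[qGens (qCoord ψ)]` — with `qGens_invariant` / `qGens_independent` the invariants are
exactly `⟨[ψ₁], [ψ₂], [ψ₃]⟩`, dimension `3` ('translation by one vector: h0(Q) 3'). Contrast
`exists_preimage_of_invariant`: adding `t2` and `c` kills all of them. -/
theorem q_decomposition (ψ : Fin 12 → ZMod 3) (h : projC *ᵥ ((actY_t1 - 1) *ᵥ ψ) = 0) :
    projC *ᵥ (ψ - qGens *ᵥ (qCoord *ᵥ ψ)) = 0 := by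
  have e := congrArg (fun M => M *ᵥ ψ) q_identity
  have hs : (1 - qGens * qCoord) *ᵥ ψ = ψ - qGens *ᵥ (qCoord *ᵥ ψ) := by
    rw [Matrix.sub_mulVec, Matrix.one_mulVec, Matrix.mulVec_mulVec]
  simp only [← Matrix.mulVec_mulVec] at e
  rw [hs, h, Matrix.mulVec_zero] at e
  exact e

end Summit.BirchSwinnertonDyer.Rank1Residual.SecondDescent.HesseCokernel
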